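import Summits.QuantumFields.YangMills.Theorems.UnitScaleTiltProp7CovariantActionHS
import HarnessLib

/-!
# Route `UnitScaleTilt`, crux K1 child «MinimiserStabilityRegPr» (stmt-QuantumFields-19200), registered stub `stub_prop7From14` (v4 828f5fb4a904d3be;
# leaf V3 «Prop 7 from a background (14)» = `T3Thm1CarrierNative.Prop7From14At`) — sub-lemma V3-F at a NON-FLAT background, part 2/2: THE NON-FLAT
# LOCAL-MINIMALITY MODEL OF (141)–(143) ON THE COVARIANT SLICE — the `SU(2)` Wilson action grows quadratically off a small-field background `U₀` at print's
# rate `L^{−2k}`, once its exact first variation is subtracted, uniformly in the volume, `n`, `K`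

Cell `ym3-torus` ∕ fleet seat `ym-ust-19200-p1` (HUMAN RULING D-0037, YM ladder rung R3), successor g2.  WHERE THIS SITS.  [Balaban1985Variational] p. 299:
«A second order differential at A′ = 0 … is positive definite. Hence A′ = 0 is a minimum» — the minimality half of Prop. 7 rests on [Balaban1985BackgroundPropagators]
Thm 3.11 at the background `U₀` of (14).  The predecessor seat's `UnitScaleTiltProp7FlatLocalMinimality` is the model at the FLAT datum (`U₀ = 1`); THIS FILE is
the model at an ARBITRARY SMALL-FIELD BACKGROUND: it composes the per-plaquette expansion of `UnitScaleTiltProp7CovariantPlaquetteExpansion` (exact linear part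
`L_p`, remainder `≤ 2(Σ‖Y‖)²`), the Hilbert–Schmidt bookkeeping of `UnitScaleTiltProp7CovariantActionHS`, and the small-field Thm 3.11 in `L²` form
(`UnitScaleTiltProp7SmallFieldThm311.sum_normSq_le_curl_sq_add_divB_sq_T3`).

WHAT IS PROVED (sorry-free, no definition; our own statements — [folklore] ∕ cited to the printed step they model):
* §5 `norm_plaqHol_mul_star_bg_sub_one_sub_lin_le` (the exact-linear-part expansion on the lattice), `quarter_hs_expansion_abstract` and
  **`quarter_hs_plaq_expansion_ge`** — PER PLAQUETTE, `SU(2)`: `¼‖U(∂p) − 1‖²_HS ≥ ¼‖U₀(∂p) − 1‖²_HS + ½Re Tr((U₀(∂p) − 1)^*·L_pU₀(∂p)) + (1/16)‖(D_{U₀}Y)(p)‖²_HS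
  − (2a² + 128δ² + 8a)·Σ_{b∈∂p}‖Y(b)‖²` (`‖U₀(∂p) − 1‖ ≤ a`, `‖Y(b)‖ ≤ δ ≤ 1`, `Y(b) = U(b)U₀(b)^* − 1`);
* §6 **`wilsonAction4_sub_background_ge_T3`** — AT THE d = 3 CARRIER (`Site (F.P K) 0`, `k = K − n`): if `dist1(U₀(∂p)) ≤ εL^{−2(K−n)}` for all `p`, `216ε ≤ 1`,
  `‖Y(b)‖ ≤ δ ≤ 1`, and `Y` lies on the COVARIANT SLICE (`(D^*_{U₀}Y)(x) = 0` — covariant Landau gauge, the tree's `B9Eq39Adjoint.divB` — and vanishing covariant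
  straight-line block averages, the linear model of print's chart (20)–(21)), then with `a = εL^{−2(K−n)}`
  `((1/288)L^{−2(K−n)} − 12(2a² + 128δ² + 8a))·Σ_b‖Y(b)‖² ≤ A(U) − A(U₀) − ½Σ_p Re Tr((U₀(∂p) − 1)^*·L_p·U₀(∂p))`
  — quadratic growth at print's rate `L^{−2k}` with the regular radii `a ~ L^{−2k}` (plaquettes, (6)) and `δ ~ L^{−k}` (bonds, (19)), ABSOLUTE constants.

WHAT THIS IS NOT.  A MODEL: the covariant slice is the linearised constraint/gauge at `U₀`, not the family's nonlinear (0.4)-fibre with print's gauge (4)/(21) —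
the transfer needs the gauge chart (V3-A, [Balaban1985RegularSpaces] Thm 2), the right inverse of the linearised averaging (V3-C) and the identification of the
covariant straight-line average with `d(descendTo)_{U₀}` (V3-D1c); the subtracted first variation `Lin_{U₀}(U)` vanishes only at a critical background (print's
`U_k` from the contraction of Sects. D–E, V3-E).  Nothing of Bałaban's is asserted.

References: T. Bałaban, CMP 102 (1985) 277–309 [Balaban1985Variational] ((6) p.278, (14) p.280, (19)–(21) p.281, (26)–(31) pp.282–283, (141)–(143) p.299);
CMP 99 (1985) 389–434 [Balaban1985BackgroundPropagators] (Thm 3.11 p.416, (3.4) p.391, (3.8) p.392).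
-/

noncomputable section

open scoped BigOperators Matrix.Norms.L2Operator Matrix

namespace Summit.QuantumFields.YangMills.Theorems.Prop7CovariantCoercivity

open Literature.MathematicalPhysics.QuantumFieldTheory.Balaban1983to89
open Finset B1RG242Torus
open B9Eq39Adjoint (R R_def covD curl)
open B7Eq78Linearization (conjR)
open B10Eq27TorusAxialLog (unitsField toUField unitsField_mem_unitaryUnits val_unitsField)
open B9TorusCalculus (torusT torusT_apply)
open Summit.QuantumFields.YangMills.Theorems.Prop7FlatExpansion (norm_plaq_sub_one_sub_lin_le coe_plaqHol)
open Summit.QuantumFields.YangMills.Theorems.AvgCurvGrad (norm_coe_su norm_coe_conj_sub_conj)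

variable {n : Type*} [Fintype n] [DecidableEq n]

/-! ## §5 The non-flat local-minimality model on the covariant slice at the d = 3 carrier -/

section LocalMin

open B10StarCount (sum_pbond)
open B10Eq27TorusAxialLog (holT unitsField toUField unitsField_mem_unitaryUnits)
open B7Prop1Explicit (treeWord)
open B9Eq39Adjoint (divB)
open Summit.QuantumFields.YangMills.Theorems.Prop7FlatLocalMin (sum_plaq_bonds_le)

variable {P : Params} {j : ℕ} {N : ℕ} [NeZero N]

/-- The exact-linear-part expansion ON THE LATTICE (twin of `norm_plaqHol_mul_star_bg_sub_one_sub_covCurl_le` with the transports `Q = U₀(b₁)U₀(b₂)U₀(b₃)⁻¹`,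
`P₀ = U₀(∂p)` kept): remainder `≤ 2(Σ_{b∈∂p}‖Y(b)‖)²`. [cite: Balaban1985Variational, (22)-(26) pp.281-282] -/
theorem norm_plaqHol_mul_star_bg_sub_one_sub_lin_le (U U₀ : GaugeField P j (Matrix.specialUnitaryGroup (Fin N) ℂ)) (p : Plaq P j)
    (h₁ : ‖(U ⟨p.src, p.μ⟩ : Matrix (Fin N) (Fin N) ℂ) * star (U₀ ⟨p.src, p.μ⟩ : Matrix (Fin N) (Fin N) ℂ) - 1‖ ≤ 1)
    (h₃ : ‖(U ⟨p.src.shift p.ν, p.μ⟩ : Matrix (Fin N) (Fin N) ℂ) * star (U₀ ⟨p.src.shift p.ν, p.μ⟩ : Matrix (Fin N) (Fin N) ℂ) - 1‖ ≤ 1) :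
    ‖((GaugeField.plaqHol U p : Matrix.specialUnitaryGroup (Fin N) ℂ) : Matrix (Fin N) (Fin N) ℂ)
          * star ((GaugeField.plaqHol U₀ p : Matrix.specialUnitaryGroup (Fin N) ℂ) : Matrix (Fin N) (Fin N) ℂ) - 1
        - (((U ⟨p.src, p.μ⟩ : Matrix (Fin N) (Fin N) ℂ) * star (U₀ ⟨p.src, p.μ⟩ : Matrix (Fin N) (Fin N) ℂ) - 1)
            + (U₀ ⟨p.src, p.μ⟩ : Matrix (Fin N) (Fin N) ℂ)
                * ((U ⟨p.src.shift p.μ, p.ν⟩ : Matrix (Fin N) (Fin N) ℂ) * star (U₀ ⟨p.src.shift p.μ, p.ν⟩ : Matrix (Fin N) (Fin N) ℂ) - 1)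
                * star (U₀ ⟨p.src, p.μ⟩ : Matrix (Fin N) (Fin N) ℂ)
            - ((U₀ ⟨p.src, p.μ⟩ * U₀ ⟨p.src.shift p.μ, p.ν⟩ * (U₀ ⟨p.src.shift p.ν, p.μ⟩)⁻¹ : Matrix.specialUnitaryGroup (Fin N) ℂ) : Matrix (Fin N) (Fin N) ℂ)
                * ((U ⟨p.src.shift p.ν, p.μ⟩ : Matrix (Fin N) (Fin N) ℂ) * star (U₀ ⟨p.src.shift p.ν, p.μ⟩ : Matrix (Fin N) (Fin N) ℂ) - 1)
                * star ((U₀ ⟨p.src, p.μ⟩ * U₀ ⟨p.src.shift p.μ, p.ν⟩ * (U₀ ⟨p.src.shift p.ν, p.μ⟩)⁻¹ : Matrix.specialUnitaryGroup (Fin N) ℂ) : Matrix (Fin N) (Fin N) ℂ)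
            - ((GaugeField.plaqHol U₀ p : Matrix.specialUnitaryGroup (Fin N) ℂ) : Matrix (Fin N) (Fin N) ℂ)
                * ((U ⟨p.src, p.ν⟩ : Matrix (Fin N) (Fin N) ℂ) * star (U₀ ⟨p.src, p.ν⟩ : Matrix (Fin N) (Fin N) ℂ) - 1)
                * star ((GaugeField.plaqHol U₀ p : Matrix.specialUnitaryGroup (Fin N) ℂ) : Matrix (Fin N) (Fin N) ℂ))‖
      ≤ 2 * (‖(U ⟨p.src, p.μ⟩ : Matrix (Fin N) (Fin N) ℂ) * star (U₀ ⟨p.src, p.μ⟩ : Matrix (Fin N) (Fin N) ℂ) - 1‖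
              + ‖(U ⟨p.src.shift p.μ, p.ν⟩ : Matrix (Fin N) (Fin N) ℂ) * star (U₀ ⟨p.src.shift p.μ, p.ν⟩ : Matrix (Fin N) (Fin N) ℂ) - 1‖
              + ‖(U ⟨p.src.shift p.ν, p.μ⟩ : Matrix (Fin N) (Fin N) ℂ) * star (U₀ ⟨p.src.shift p.ν, p.μ⟩ : Matrix (Fin N) (Fin N) ℂ) - 1‖
              + ‖(U ⟨p.src, p.ν⟩ : Matrix (Fin N) (Fin N) ℂ) * star (U₀ ⟨p.src, p.ν⟩ : Matrix (Fin N) (Fin N) ℂ) - 1‖) ^ 2 := by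
  set W₁ := U ⟨p.src, p.μ⟩ * (U₀ ⟨p.src, p.μ⟩)⁻¹ with hW₁
  set W₂ := U ⟨p.src.shift p.μ, p.ν⟩ * (U₀ ⟨p.src.shift p.μ, p.ν⟩)⁻¹ with hW₂
  set W₃ := U ⟨p.src.shift p.ν, p.μ⟩ * (U₀ ⟨p.src.shift p.ν, p.μ⟩)⁻¹ with hW₃
  set W₄ := U ⟨p.src, p.ν⟩ * (U₀ ⟨p.src, p.ν⟩)⁻¹ with hW₄
  have hU : GaugeField.plaqHol U p
      = (W₁ * U₀ ⟨p.src, p.μ⟩) * (W₂ * U₀ ⟨p.src.shift p.μ, p.ν⟩) * (W₃ * U₀ ⟨p.src.shift p.ν, p.μ⟩)⁻¹ * (W₄ * U₀ ⟨p.src, p.ν⟩)⁻¹ := by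
    rw [plaqHol_eq_word, hW₁, hW₂, hW₃, hW₄]
    simp only [inv_mul_cancel_right]
  have hU₀ : GaugeField.plaqHol U₀ p
      = U₀ ⟨p.src, p.μ⟩ * U₀ ⟨p.src.shift p.μ, p.ν⟩ * (U₀ ⟨p.src.shift p.ν, p.μ⟩)⁻¹ * (U₀ ⟨p.src, p.ν⟩)⁻¹ := plaqHol_eq_word U₀ p
  have e₁ : (U ⟨p.src, p.μ⟩ : Matrix (Fin N) (Fin N) ℂ) * star (U₀ ⟨p.src, p.μ⟩ : Matrix (Fin N) (Fin N) ℂ) - 1 = (W₁ : Matrix (Fin N) (Fin N) ℂ) - 1 :=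
    (coe_mul_inv_sub_one _ _).symm
  have e₂ : (U ⟨p.src.shift p.μ, p.ν⟩ : Matrix (Fin N) (Fin N) ℂ) * star (U₀ ⟨p.src.shift p.μ, p.ν⟩ : Matrix (Fin N) (Fin N) ℂ) - 1
      = (W₂ : Matrix (Fin N) (Fin N) ℂ) - 1 := (coe_mul_inv_sub_one _ _).symm
  have e₃ : (U ⟨p.src.shift p.ν, p.μ⟩ : Matrix (Fin N) (Fin N) ℂ) * star (U₀ ⟨p.src.shift p.ν, p.μ⟩ : Matrix (Fin N) (Fin N) ℂ) - 1
      = (W₃ : Matrix (Fin N) (Fin N) ℂ) - 1 := (coe_mul_inv_sub_one _ _).symm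
  have e₄ : (U ⟨p.src, p.ν⟩ : Matrix (Fin N) (Fin N) ℂ) * star (U₀ ⟨p.src, p.ν⟩ : Matrix (Fin N) (Fin N) ℂ) - 1 = (W₄ : Matrix (Fin N) (Fin N) ℂ) - 1 :=
    (coe_mul_inv_sub_one _ _).symm
  rw [hU, hU₀, e₁, e₂, e₃, e₄]
  rw [e₁] at h₁
  rw [e₃] at h₃
  exact norm_plaq_mul_star_bg_sub_one_sub_lin_le W₁ W₂ W₃ W₄ _ _ _ _ h₁ h₃

/-- The Hilbert–Schmidt expansion inequality of part 1 at `N = 2`, with the deviation `X = E + (L + r)P₀` named. [cite: Balaban1985Variational, (26)-(31) pp.282-283] -/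
theorem sum_norm_sq_expansion_ge_two {X E L r F P₀ : Matrix (Fin 2) (Fin 2) ℂ} (hP : P₀ ∈ Matrix.unitaryGroup (Fin 2) ℂ) (hX : X = E + (L + r) * P₀) :
    ∑ j : Fin 2, ∑ k : Fin 2, ‖E j k‖ ^ 2 + 2 * ((Eᴴ * (L * P₀)).trace).re
        + (1 / 4) * ∑ j : Fin 2, ∑ k : Fin 2, ‖F j k‖ ^ 2 - (1 / 2) * ∑ j : Fin 2, ∑ k : Fin 2, ‖(L - F) j k‖ ^ 2
        - ∑ j : Fin 2, ∑ k : Fin 2, ‖r j k‖ ^ 2 - 4 * ‖E‖ * ‖r‖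
      ≤ ∑ j : Fin 2, ∑ k : Fin 2, ‖X j k‖ ^ 2 := by
  have h := sum_norm_sq_expansion_ge (E := E) (L := L) (r := r) (F := F) hP
  rw [hX]
  simp only [Nat.cast_ofNat] at h
  linarith
set_option maxHeartbeats 400000 in
/-- **THE PER-PLAQUETTE EXPANSION, ABSTRACT FORM** (`SU(2)`, `M₂(ℂ)`): given the background plaquette `P₀` (unitary, `‖P₀ − 1‖ ≤ a`), the competitor's
plaquette `Pl`, fluctuations `Y_i` of norm `≤ δ`, the exact linear part `L` with its second-order remainder bound and the covariant curl `F` with its curvature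
bound against `L`: `¼Σ|(P₀−1)_jk|² + ½Re Tr((P₀−1)^*·LP₀) + (1/16)Σ|F_jk|² − (2a² + 128δ² + 8a)Σ_i‖Y_i‖² ≤ ¼Σ|(Pl−1)_jk|²`.
[cite: Balaban1985Variational, (26)-(31) pp.282-283, (141)-(143) p.299] -/
theorem quarter_hs_expansion_abstract (Pl P₀ Y₁ Y₂ Y₃ Y₄ L Fc : Matrix (Fin 2) (Fin 2) ℂ) {a δ : ℝ} (ha : 0 ≤ a)
    (hP₀u : P₀ ∈ Matrix.unitaryGroup (Fin 2) ℂ) (hE : ‖P₀ - 1‖ ≤ a)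
    (s₁ : ‖Y₁‖ ≤ δ) (s₂ : ‖Y₂‖ ≤ δ) (s₃ : ‖Y₃‖ ≤ δ) (s₄ : ‖Y₄‖ ≤ δ)
    (hr : ‖Pl * star P₀ - 1 - L‖ ≤ 2 * (‖Y₁‖ + ‖Y₂‖ + ‖Y₃‖ + ‖Y₄‖) ^ 2)
    (hLF : ‖L - Fc‖ ≤ 2 * ‖P₀ - 1‖ * (‖Y₃‖ + ‖Y₄‖)) :
    (1 / 4) * ∑ i₁ : Fin 2, ∑ i₂ : Fin 2, ‖(P₀ - 1) i₁ i₂‖ ^ 2 + (1 / 2) * (((P₀ - 1)ᴴ * (L * P₀)).trace).re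
      + (1 / 16) * ∑ i₁ : Fin 2, ∑ i₂ : Fin 2, ‖Fc i₁ i₂‖ ^ 2
      - (2 * a ^ 2 + 128 * δ ^ 2 + 8 * a) * (‖Y₁‖ ^ 2 + ‖Y₂‖ ^ 2 + ‖Y₃‖ ^ 2 + ‖Y₄‖ ^ 2)
      ≤ (1 / 4) * ∑ i₁ : Fin 2, ∑ i₂ : Fin 2, ‖(Pl - 1) i₁ i₂‖ ^ 2 := by
  have n₁ : 0 ≤ ‖Y₁‖ := norm_nonneg _
  have n₂ : 0 ≤ ‖Y₂‖ := norm_nonneg _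
  have n₃ : 0 ≤ ‖Y₃‖ := norm_nonneg _
  have n₄ : 0 ≤ ‖Y₄‖ := norm_nonneg _
  have hδ0 : 0 ≤ δ := n₁.trans s₁
  have hS0 : 0 ≤ ‖Y₁‖ + ‖Y₂‖ + ‖Y₃‖ + ‖Y₄‖ := by linarith only [n₁, n₂, n₃, n₄]
  have hS4 : ‖Y₁‖ + ‖Y₂‖ + ‖Y₃‖ + ‖Y₄‖ ≤ 4 * δ := by linarith only [s₁, s₂, s₃, s₄]
  -- the algebraic identity `Pl − 1 = (P₀ − 1) + (L + r)P₀`, `r = PlP₀^* − 1 − L`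
  have hX : Pl - 1 = (P₀ - 1) + (L + (Pl * star P₀ - 1 - L)) * P₀ := by
    have hPP : star P₀ * P₀ = 1 := Matrix.mem_unitaryGroup_iff'.mp hP₀u
    rw [add_sub_cancel, sub_mul, mul_assoc, hPP, mul_one, one_mul]
    abel
  have hexp := sum_norm_sq_expansion_ge_two (F := Fc) hP₀u hX
  -- error terms
  have hE0 : 0 ≤ ‖P₀ - 1‖ := norm_nonneg _
  have t1 : ∑ j : Fin 2, ∑ k : Fin 2, ‖(L - Fc) j k‖ ^ 2 ≤ 8 * a ^ 2 * (‖Y₃‖ + ‖Y₄‖) ^ 2 := by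
    refine (sum_norm_sq_le_mul_opNorm_sq (L - Fc)).trans ?_
    have h2 : ‖L - Fc‖ ^ 2 ≤ (2 * ‖P₀ - 1‖ * (‖Y₃‖ + ‖Y₄‖)) ^ 2 := pow_le_pow_left₀ (norm_nonneg _) hLF 2
    have h3' : 2 * ‖P₀ - 1‖ * (‖Y₃‖ + ‖Y₄‖) ≤ 2 * a * (‖Y₃‖ + ‖Y₄‖) :=
      mul_le_mul_of_nonneg_right (mul_le_mul_of_nonneg_left hE zero_le_two) (add_nonneg n₃ n₄)
    have h30 : 0 ≤ 2 * ‖P₀ - 1‖ * (‖Y₃‖ + ‖Y₄‖) := mul_nonneg (mul_nonneg zero_le_two hE0) (add_nonneg n₃ n₄)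
    have h3 : (2 * ‖P₀ - 1‖ * (‖Y₃‖ + ‖Y₄‖)) ^ 2 ≤ (2 * a * (‖Y₃‖ + ‖Y₄‖)) ^ 2 := pow_le_pow_left₀ h30 h3' 2
    have h4 : ‖L - Fc‖ ^ 2 ≤ 4 * a ^ 2 * (‖Y₃‖ + ‖Y₄‖) ^ 2 := (h2.trans h3).trans (le_of_eq (by ring))
    push_cast
    linarith only [h4]
  have t2 : ∑ j : Fin 2, ∑ k : Fin 2, ‖(Pl * star P₀ - 1 - L) j k‖ ^ 2 ≤ 8 * (‖Y₁‖ + ‖Y₂‖ + ‖Y₃‖ + ‖Y₄‖) ^ 4 := by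
    refine (sum_norm_sq_le_mul_opNorm_sq _).trans ?_
    have h2 : ‖Pl * star P₀ - 1 - L‖ ^ 2 ≤ (2 * (‖Y₁‖ + ‖Y₂‖ + ‖Y₃‖ + ‖Y₄‖) ^ 2) ^ 2 := pow_le_pow_left₀ (norm_nonneg _) hr 2
    have h4 : ‖Pl * star P₀ - 1 - L‖ ^ 2 ≤ 4 * (‖Y₁‖ + ‖Y₂‖ + ‖Y₃‖ + ‖Y₄‖) ^ 4 := h2.trans (le_of_eq (by ring))
    push_cast
    linarith only [h4]
  have t3 : 4 * ‖P₀ - 1‖ * ‖Pl * star P₀ - 1 - L‖ ≤ 8 * a * (‖Y₁‖ + ‖Y₂‖ + ‖Y₃‖ + ‖Y₄‖) ^ 2 := by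
    have := mul_le_mul hE hr (norm_nonneg _) ha
    linarith only [this]
  -- polynomial bookkeeping
  have hsq4 : ∀ s₁ s₂ s₃ s₄ : ℝ, (s₁ + s₂ + s₃ + s₄) ^ 2 ≤ 4 * (s₁ ^ 2 + s₂ ^ 2 + s₃ ^ 2 + s₄ ^ 2) := fun s₁ s₂ s₃ s₄ => by
    nlinarith [sq_nonneg (s₁ - s₂), sq_nonneg (s₁ - s₃), sq_nonneg (s₁ - s₄), sq_nonneg (s₂ - s₃), sq_nonneg (s₂ - s₄), sq_nonneg (s₃ - s₄)]
  have hsq : (‖Y₁‖ + ‖Y₂‖ + ‖Y₃‖ + ‖Y₄‖) ^ 2 ≤ 4 * (‖Y₁‖ ^ 2 + ‖Y₂‖ ^ 2 + ‖Y₃‖ ^ 2 + ‖Y₄‖ ^ 2) := hsq4 _ _ _ _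
  have h34' : ∀ y₁ y₂ y₃ y₄ : ℝ, (y₃ + y₄) ^ 2 ≤ 2 * (y₁ ^ 2 + y₂ ^ 2 + y₃ ^ 2 + y₄ ^ 2) := fun y₁ y₂ y₃ y₄ => by
    nlinarith [sq_nonneg (y₃ - y₄), sq_nonneg y₁, sq_nonneg y₂]
  have h34 : (‖Y₃‖ + ‖Y₄‖) ^ 2 ≤ 2 * (‖Y₁‖ ^ 2 + ‖Y₂‖ ^ 2 + ‖Y₃‖ ^ 2 + ‖Y₄‖ ^ 2) := h34' _ _ _ _
  have hS2 : (‖Y₁‖ + ‖Y₂‖ + ‖Y₃‖ + ‖Y₄‖) ^ 2 ≤ 16 * δ ^ 2 := by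
    rw [show (16 : ℝ) * δ ^ 2 = (4 * δ) * (4 * δ) by ring, sq]
    exact mul_le_mul hS4 hS4 hS0 (by linarith only [hδ0])
  have hS4' : (‖Y₁‖ + ‖Y₂‖ + ‖Y₃‖ + ‖Y₄‖) ^ 4 ≤ 64 * δ ^ 2 * (‖Y₁‖ ^ 2 + ‖Y₂‖ ^ 2 + ‖Y₃‖ ^ 2 + ‖Y₄‖ ^ 2) := by
    have e4 : (‖Y₁‖ + ‖Y₂‖ + ‖Y₃‖ + ‖Y₄‖) ^ 4 = (‖Y₁‖ + ‖Y₂‖ + ‖Y₃‖ + ‖Y₄‖) ^ 2 * (‖Y₁‖ + ‖Y₂‖ + ‖Y₃‖ + ‖Y₄‖) ^ 2 := by ring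
    rw [e4]
    calc _ ≤ 16 * δ ^ 2 * (4 * (‖Y₁‖ ^ 2 + ‖Y₂‖ ^ 2 + ‖Y₃‖ ^ 2 + ‖Y₄‖ ^ 2)) :=
          mul_le_mul hS2 hsq (sq_nonneg _) (mul_nonneg (by norm_num) (sq_nonneg δ))
      _ = _ := by ring
  have hsum0 : 0 ≤ ‖Y₁‖ ^ 2 + ‖Y₂‖ ^ 2 + ‖Y₃‖ ^ 2 + ‖Y₄‖ ^ 2 :=
    add_nonneg (add_nonneg (add_nonneg (sq_nonneg _) (sq_nonneg _)) (sq_nonneg _)) (sq_nonneg _)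
  have ea : 8 * a ^ 2 * (‖Y₃‖ + ‖Y₄‖) ^ 2 ≤ 8 * a ^ 2 * (2 * (‖Y₁‖ ^ 2 + ‖Y₂‖ ^ 2 + ‖Y₃‖ ^ 2 + ‖Y₄‖ ^ 2)) :=
    mul_le_mul_of_nonneg_left h34 (mul_nonneg (by norm_num) (sq_nonneg a))
  have eb : 8 * (‖Y₁‖ + ‖Y₂‖ + ‖Y₃‖ + ‖Y₄‖) ^ 4 ≤ 8 * (64 * δ ^ 2 * (‖Y₁‖ ^ 2 + ‖Y₂‖ ^ 2 + ‖Y₃‖ ^ 2 + ‖Y₄‖ ^ 2)) := by linarith only [hS4']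
  have ec : 8 * a * (‖Y₁‖ + ‖Y₂‖ + ‖Y₃‖ + ‖Y₄‖) ^ 2 ≤ 8 * a * (4 * (‖Y₁‖ ^ 2 + ‖Y₂‖ ^ 2 + ‖Y₃‖ ^ 2 + ‖Y₄‖ ^ 2)) :=
    mul_le_mul_of_nonneg_left hsq (mul_nonneg (by norm_num) ha)
  have f1 : (1 / 8) * ∑ j : Fin 2, ∑ k : Fin 2, ‖(L - Fc) j k‖ ^ 2 ≤ 2 * (a ^ 2 * (‖Y₁‖ ^ 2 + ‖Y₂‖ ^ 2 + ‖Y₃‖ ^ 2 + ‖Y₄‖ ^ 2)) := by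
    linarith only [t1, ea]
  have f2 : (1 / 4) * ∑ j : Fin 2, ∑ k : Fin 2, ‖(Pl * star P₀ - 1 - L) j k‖ ^ 2 ≤ 128 * (δ ^ 2 * (‖Y₁‖ ^ 2 + ‖Y₂‖ ^ 2 + ‖Y₃‖ ^ 2 + ‖Y₄‖ ^ 2)) := by
    linarith only [t2, hS4']
  have f3 : (1 / 4) * (4 * ‖P₀ - 1‖ * ‖Pl * star P₀ - 1 - L‖) ≤ 8 * (a * (‖Y₁‖ ^ 2 + ‖Y₂‖ ^ 2 + ‖Y₃‖ ^ 2 + ‖Y₄‖ ^ 2)) := by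
    linarith only [t3, ec]
  have hg : (2 * a ^ 2 + 128 * δ ^ 2 + 8 * a) * (‖Y₁‖ ^ 2 + ‖Y₂‖ ^ 2 + ‖Y₃‖ ^ 2 + ‖Y₄‖ ^ 2)
      = 2 * (a ^ 2 * (‖Y₁‖ ^ 2 + ‖Y₂‖ ^ 2 + ‖Y₃‖ ^ 2 + ‖Y₄‖ ^ 2)) + 128 * (δ ^ 2 * (‖Y₁‖ ^ 2 + ‖Y₂‖ ^ 2 + ‖Y₃‖ ^ 2 + ‖Y₄‖ ^ 2))
        + 8 * (a * (‖Y₁‖ ^ 2 + ‖Y₂‖ ^ 2 + ‖Y₃‖ ^ 2 + ‖Y₄‖ ^ 2)) := by ring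
  rw [hg]
  linarith only [hexp, f1, f2, f3]

/-- **PER PLAQUETTE ON THE LATTICE, `SU(2)`**: the Hilbert–Schmidt deviation of `U(∂p)` exceeds that of `U₀(∂p)` by the exact linear term plus `1/16` of the
covariant curl form, up to `(2a² + 128δ² + 8a)·Σ_{b∈∂p}‖Y(b)‖²` (`‖U₀(∂p) − 1‖ ≤ a`, `‖Y(b)‖ ≤ δ ≤ 1`). [cite: Balaban1985Variational, (26)-(31) pp.282-283] -/
theorem quarter_hs_plaq_expansion_ge (U U₀ : GaugeField P j (Matrix.specialUnitaryGroup (Fin 2) ℂ)) (p : Plaq P j) {a δ : ℝ} (ha : 0 ≤ a)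
    (hE : ‖((GaugeField.plaqHol U₀ p : Matrix.specialUnitaryGroup (Fin 2) ℂ) : Matrix (Fin 2) (Fin 2) ℂ) - 1‖ ≤ a)
    (hδ : ∀ b : PBond P j, ‖(U b : Matrix (Fin 2) (Fin 2) ℂ) * star (U₀ b : Matrix (Fin 2) (Fin 2) ℂ) - 1‖ ≤ δ) (hδ1 : δ ≤ 1) :
    (1 / 4) * ∑ i₁ : Fin 2, ∑ i₂ : Fin 2, ‖((((GaugeField.plaqHol U₀ p : Matrix.specialUnitaryGroup (Fin 2) ℂ) : Matrix (Fin 2) (Fin 2) ℂ)) - 1) i₁ i₂‖ ^ 2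
      + (1 / 2) * ((((((GaugeField.plaqHol U₀ p : Matrix.specialUnitaryGroup (Fin 2) ℂ) : Matrix (Fin 2) (Fin 2) ℂ)) - 1)ᴴ
          * ((((U ⟨p.src, p.μ⟩ : Matrix (Fin 2) (Fin 2) ℂ) * star (U₀ ⟨p.src, p.μ⟩ : Matrix (Fin 2) (Fin 2) ℂ) - 1)
              + (U₀ ⟨p.src, p.μ⟩ : Matrix (Fin 2) (Fin 2) ℂ)
                  * ((U ⟨p.src.shift p.μ, p.ν⟩ : Matrix (Fin 2) (Fin 2) ℂ) * star (U₀ ⟨p.src.shift p.μ, p.ν⟩ : Matrix (Fin 2) (Fin 2) ℂ) - 1)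
                  * star (U₀ ⟨p.src, p.μ⟩ : Matrix (Fin 2) (Fin 2) ℂ)
              - ((U₀ ⟨p.src, p.μ⟩ * U₀ ⟨p.src.shift p.μ, p.ν⟩ * (U₀ ⟨p.src.shift p.ν, p.μ⟩)⁻¹ : Matrix.specialUnitaryGroup (Fin 2) ℂ) : Matrix (Fin 2) (Fin 2) ℂ)
                  * ((U ⟨p.src.shift p.ν, p.μ⟩ : Matrix (Fin 2) (Fin 2) ℂ) * star (U₀ ⟨p.src.shift p.ν, p.μ⟩ : Matrix (Fin 2) (Fin 2) ℂ) - 1)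
                  * star ((U₀ ⟨p.src, p.μ⟩ * U₀ ⟨p.src.shift p.μ, p.ν⟩ * (U₀ ⟨p.src.shift p.ν, p.μ⟩)⁻¹ : Matrix.specialUnitaryGroup (Fin 2) ℂ) : Matrix (Fin 2) (Fin 2) ℂ)
              - ((GaugeField.plaqHol U₀ p : Matrix.specialUnitaryGroup (Fin 2) ℂ) : Matrix (Fin 2) (Fin 2) ℂ)
                  * ((U ⟨p.src, p.ν⟩ : Matrix (Fin 2) (Fin 2) ℂ) * star (U₀ ⟨p.src, p.ν⟩ : Matrix (Fin 2) (Fin 2) ℂ) - 1)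
                  * star ((GaugeField.plaqHol U₀ p : Matrix.specialUnitaryGroup (Fin 2) ℂ) : Matrix (Fin 2) (Fin 2) ℂ))
            * ((GaugeField.plaqHol U₀ p : Matrix.specialUnitaryGroup (Fin 2) ℂ) : Matrix (Fin 2) (Fin 2) ℂ))).trace).re
      + (1 / 16) * ∑ i₁ : Fin 2, ∑ i₂ : Fin 2,
          ‖(((U ⟨p.src, p.μ⟩ : Matrix (Fin 2) (Fin 2) ℂ) * star (U₀ ⟨p.src, p.μ⟩ : Matrix (Fin 2) (Fin 2) ℂ) - 1)
              + (U₀ ⟨p.src, p.μ⟩ : Matrix (Fin 2) (Fin 2) ℂ)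
                  * ((U ⟨p.src.shift p.μ, p.ν⟩ : Matrix (Fin 2) (Fin 2) ℂ) * star (U₀ ⟨p.src.shift p.μ, p.ν⟩ : Matrix (Fin 2) (Fin 2) ℂ) - 1)
                  * star (U₀ ⟨p.src, p.μ⟩ : Matrix (Fin 2) (Fin 2) ℂ)
              - (U₀ ⟨p.src, p.ν⟩ : Matrix (Fin 2) (Fin 2) ℂ)
                  * ((U ⟨p.src.shift p.ν, p.μ⟩ : Matrix (Fin 2) (Fin 2) ℂ) * star (U₀ ⟨p.src.shift p.ν, p.μ⟩ : Matrix (Fin 2) (Fin 2) ℂ) - 1)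
                  * star (U₀ ⟨p.src, p.ν⟩ : Matrix (Fin 2) (Fin 2) ℂ)
              - ((U ⟨p.src, p.ν⟩ : Matrix (Fin 2) (Fin 2) ℂ) * star (U₀ ⟨p.src, p.ν⟩ : Matrix (Fin 2) (Fin 2) ℂ) - 1)) i₁ i₂‖ ^ 2
      - (2 * a ^ 2 + 128 * δ ^ 2 + 8 * a)
          * (‖(U ⟨p.src, p.μ⟩ : Matrix (Fin 2) (Fin 2) ℂ) * star (U₀ ⟨p.src, p.μ⟩ : Matrix (Fin 2) (Fin 2) ℂ) - 1‖ ^ 2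
            + ‖(U ⟨p.src.shift p.μ, p.ν⟩ : Matrix (Fin 2) (Fin 2) ℂ) * star (U₀ ⟨p.src.shift p.μ, p.ν⟩ : Matrix (Fin 2) (Fin 2) ℂ) - 1‖ ^ 2
            + ‖(U ⟨p.src.shift p.ν, p.μ⟩ : Matrix (Fin 2) (Fin 2) ℂ) * star (U₀ ⟨p.src.shift p.ν, p.μ⟩ : Matrix (Fin 2) (Fin 2) ℂ) - 1‖ ^ 2
            + ‖(U ⟨p.src, p.ν⟩ : Matrix (Fin 2) (Fin 2) ℂ) * star (U₀ ⟨p.src, p.ν⟩ : Matrix (Fin 2) (Fin 2) ℂ) - 1‖ ^ 2)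
      ≤ (1 / 4) * ∑ i₁ : Fin 2, ∑ i₂ : Fin 2, ‖(((GaugeField.plaqHol U p : Matrix.specialUnitaryGroup (Fin 2) ℂ) : Matrix (Fin 2) (Fin 2) ℂ) - 1) i₁ i₂‖ ^ 2 :=
  by
  refine quarter_hs_expansion_abstract _ _ _ _ _ _ _ _ ha (GaugeField.plaqHol U₀ p).2.1 hE (hδ _) (hδ _) (hδ _) (hδ _)
    (norm_plaqHol_mul_star_bg_sub_one_sub_lin_le U U₀ p ((hδ _).trans hδ1) ((hδ _).trans hδ1)) ?_
  have h := norm_lin_sub_curl_le (U₀ ⟨p.src, p.μ⟩) (U₀ ⟨p.src.shift p.μ, p.ν⟩) (U₀ ⟨p.src.shift p.ν, p.μ⟩) (U₀ ⟨p.src, p.ν⟩)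
    ((U ⟨p.src.shift p.ν, p.μ⟩ : Matrix (Fin 2) (Fin 2) ℂ) * star (U₀ ⟨p.src.shift p.ν, p.μ⟩ : Matrix (Fin 2) (Fin 2) ℂ) - 1)
    ((U ⟨p.src, p.ν⟩ : Matrix (Fin 2) (Fin 2) ℂ) * star (U₀ ⟨p.src, p.ν⟩ : Matrix (Fin 2) (Fin 2) ℂ) - 1)
  rw [← plaqHol_eq_word U₀ p] at h
  refine le_trans (le_of_eq ?_) h
  rw [← norm_neg]
  congr 1
  abel

end LocalMin


/-! ## §6 The assembly at the d = 3 carrier -/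

section Assembly3

open B10StarCount (sum_pbond)
open B10Eq27TorusAxialLog (holT unitsField toUField unitsField_mem_unitaryUnits)
open B7Prop1Explicit (treeWord)
open B9Eq39Adjoint (divB)
open Summit.QuantumFields.YangMills.Theorems.Prop7FlatLocalMin (sum_plaq_bonds_le)

/-- **THE NON-FLAT LOCAL-MINIMALITY MODEL OF [Balaban1985Variational] (141)–(143) AT THE d = 3 CARRIER** (`T3Thm1Carrier.varProblem3 F n K`; `SU(2)`
configurations on `Site (F.P K) 0`, `k = K − n`): let the BACKGROUND `U₀` have plaquette variables within `εL^{−2(K−n)}` of `1` (print's (14), non-strict),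
`216ε ≤ 1`, and let the COMPETITOR `U` have fluctuation `Y(b) = U(b)U₀(b)^* − 1` of norm `≤ δ ≤ 1` lying on the COVARIANT SLICE — covariant Landau gauge
`(D^*_{U₀}Y)(x) = 0` and vanishing covariant straight-line block averages `A^{U₀}Y = 0` (the linear model of print's chart (20)–(21) at the background).  Then
`((1/288)·L^{−2(K−n)} − 12(2a² + 128δ² + 8a))·Σ_b‖Y(b)‖² ≤ A(U) − A(U₀) − Lin_{U₀}(U)`, `a = εL^{−2(K−n)}`,
where `Lin_{U₀}(U) = ½Σ_p Re Tr((U₀(∂p) − 1)^*·L_p·U₀(∂p))` is the EXACT first-order term (`L_p` the transported linear part of `U(∂p)U₀(∂p)^* − 1`): the Wilson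
action grows quadratically off the background along the covariant slice at print's rate `L^{−2k}` once its first variation is accounted for, with the
regular radii `a ~ L^{−2k}` (plaquettes) and `δ ~ L^{−k}` (bonds) of (6)/(19) — uniformly in `m`, `n`, `K`.  (At `U₀ = 1`: `Lin = 0` and this is the flat
model `Prop7FlatLocalMin.wilsonAction4_ge_quadratic_T3` with other constants.) [cite: Balaban1985Variational, (141)-(143) p.299, (14) p.280, (26)-(31) pp.282-283] -/
theorem wilsonAction4_sub_background_ge_T3 (F : T3ContinuumYM3Torus.T3Family) (n K : ℕ)
    (U U₀ : GaugeField (F.P K) 0 (Matrix.specialUnitaryGroup (Fin 2) ℂ)) {ε δ : ℝ} (hε : 0 ≤ ε) (hε1 : 216 * ε ≤ 1)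
    (hU₀ : ∀ p : Plaq (F.P K) 0, dist1 (GaugeField.plaqHol U₀ p) ≤ ε * (((F.L : ℝ) ^ (K - n)) ^ 2)⁻¹)
    (hδ : ∀ b : PBond (F.P K) 0, ‖(U b : Matrix (Fin 2) (Fin 2) ℂ) * star (U₀ b : Matrix (Fin 2) (Fin 2) ℂ) - 1‖ ≤ δ) (hδ1 : δ ≤ 1)
    (hdiv : ∀ x : Site (F.P K) 0, divB (torusT (F.P K) 0) (fun κ z => unitsField (toUField U₀) ⟨z, κ⟩)
      (fun κ z => (U ⟨z, κ⟩ : Matrix (Fin 2) (Fin 2) ℂ) * star (U₀ ⟨z, κ⟩ : Matrix (Fin 2) (Fin 2) ℂ) - 1) x = 0)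
    (havg : ∀ c : PBond (F.P K) (K - n), ∑ r : Fin (F.P K).d → Fin ((F.P K).L ^ (K - n)), ∑ t ∈ range ((F.P K).L ^ (K - n)),
        conjR (holT (unitsField (toUField U₀)) (Site.fibreSite 0 (K - n) c.src fun _ => ⟨0, pow_pos (F.P K).L_pos (K - n)⟩)
              (treeWord fun ν => ((r ν : ℕ) : ℤ))
            * holT (unitsField (toUField U₀)) (Site.fibreSite 0 (K - n) c.src r) (List.replicate t (c.dir, true)))
          ((U ⟨(fun z : Site (F.P K) 0 => z.shift c.dir)^[t] (Site.fibreSite 0 (K - n) c.src r), c.dir⟩ : Matrix (Fin 2) (Fin 2) ℂ)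
              * star (U₀ ⟨(fun z : Site (F.P K) 0 => z.shift c.dir)^[t] (Site.fibreSite 0 (K - n) c.src r), c.dir⟩ : Matrix (Fin 2) (Fin 2) ℂ) - 1) = 0) :
    ((1 / 288) * (((F.L : ℝ) ^ (K - n)) ^ 2)⁻¹
        - 12 * (2 * (ε * (((F.L : ℝ) ^ (K - n)) ^ 2)⁻¹) ^ 2 + 128 * δ ^ 2 + 8 * (ε * (((F.L : ℝ) ^ (K - n)) ^ 2)⁻¹)))
        * ∑ b : PBond (F.P K) 0, ‖(U b : Matrix (Fin 2) (Fin 2) ℂ) * star (U₀ b : Matrix (Fin 2) (Fin 2) ℂ) - 1‖ ^ 2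
      ≤ wilsonAction4 U - wilsonAction4 U₀
        - ∑ p : Plaq (F.P K) 0, (1 / 2) * ((((((GaugeField.plaqHol U₀ p : Matrix.specialUnitaryGroup (Fin 2) ℂ) : Matrix (Fin 2) (Fin 2) ℂ)) - 1)ᴴ
          * ((((U ⟨p.src, p.μ⟩ : Matrix (Fin 2) (Fin 2) ℂ) * star (U₀ ⟨p.src, p.μ⟩ : Matrix (Fin 2) (Fin 2) ℂ) - 1)
              + (U₀ ⟨p.src, p.μ⟩ : Matrix (Fin 2) (Fin 2) ℂ)
                  * ((U ⟨p.src.shift p.μ, p.ν⟩ : Matrix (Fin 2) (Fin 2) ℂ) * star (U₀ ⟨p.src.shift p.μ, p.ν⟩ : Matrix (Fin 2) (Fin 2) ℂ) - 1)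
                  * star (U₀ ⟨p.src, p.μ⟩ : Matrix (Fin 2) (Fin 2) ℂ)
              - ((U₀ ⟨p.src, p.μ⟩ * U₀ ⟨p.src.shift p.μ, p.ν⟩ * (U₀ ⟨p.src.shift p.ν, p.μ⟩)⁻¹ : Matrix.specialUnitaryGroup (Fin 2) ℂ) : Matrix (Fin 2) (Fin 2) ℂ)
                  * ((U ⟨p.src.shift p.ν, p.μ⟩ : Matrix (Fin 2) (Fin 2) ℂ) * star (U₀ ⟨p.src.shift p.ν, p.μ⟩ : Matrix (Fin 2) (Fin 2) ℂ) - 1)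
                  * star ((U₀ ⟨p.src, p.μ⟩ * U₀ ⟨p.src.shift p.μ, p.ν⟩ * (U₀ ⟨p.src.shift p.ν, p.μ⟩)⁻¹ : Matrix.specialUnitaryGroup (Fin 2) ℂ) : Matrix (Fin 2) (Fin 2) ℂ)
              - ((GaugeField.plaqHol U₀ p : Matrix.specialUnitaryGroup (Fin 2) ℂ) : Matrix (Fin 2) (Fin 2) ℂ)
                  * ((U ⟨p.src, p.ν⟩ : Matrix (Fin 2) (Fin 2) ℂ) * star (U₀ ⟨p.src, p.ν⟩ : Matrix (Fin 2) (Fin 2) ℂ) - 1)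
                  * star ((GaugeField.plaqHol U₀ p : Matrix.specialUnitaryGroup (Fin 2) ℂ) : Matrix (Fin 2) (Fin 2) ℂ))
            * ((GaugeField.plaqHol U₀ p : Matrix.specialUnitaryGroup (Fin 2) ℂ) : Matrix (Fin 2) (Fin 2) ℂ))).trace).re := by
  set Y : PBond (F.P K) 0 → Matrix (Fin 2) (Fin 2) ℂ := fun b => (U b : Matrix (Fin 2) (Fin 2) ℂ) * star (U₀ b : Matrix (Fin 2) (Fin 2) ℂ) - 1 with hY
  set a : ℝ := ε * (((F.L : ℝ) ^ (K - n)) ^ 2)⁻¹ with ha_def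
  have hL0 : (0 : ℝ) < ((F.L : ℝ) ^ (K - n)) ^ 2 := by
    have : (0 : ℝ) < F.L := by have := F.hL.2; exact_mod_cast (by omega : 0 < F.L)
    positivity
  have ha : 0 ≤ a := mul_nonneg hε (inv_pos.mpr hL0).le
  -- (1) the per-plaquette expansion, summed
  have hper := fun p : Plaq (F.P K) 0 => quarter_hs_plaq_expansion_ge U U₀ p ha (hU₀ p) hδ hδ1
  have hsum := Finset.sum_le_sum fun p (_ : p ∈ (Finset.univ : Finset (Plaq (F.P K) 0))) => hper p
  rw [← wilsonAction4_eq_quarter_sum_hs U] at hsum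
  simp only [Finset.sum_sub_distrib, Finset.sum_add_distrib, ← Finset.mul_sum] at hsum
  have hA0 : (1 / 4 : ℝ) * ∑ p : Plaq (F.P K) 0, ∑ i₁ : Fin 2, ∑ i₂ : Fin 2,
      ‖((((GaugeField.plaqHol U₀ p : Matrix.specialUnitaryGroup (Fin 2) ℂ) : Matrix (Fin 2) (Fin 2) ℂ)) - 1) i₁ i₂‖ ^ 2 = wilsonAction4 U₀ := by
    rw [wilsonAction4_eq_quarter_sum_hs, Finset.mul_sum]
  rw [hA0] at hsum
  -- (2) the covariant curl form through Thm 3.11 at the small-field background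
  have hcurl : ∑ p : Plaq (F.P K) 0, ∑ i₁ : Fin 2, ∑ i₂ : Fin 2,
        ‖(((U ⟨p.src, p.μ⟩ : Matrix (Fin 2) (Fin 2) ℂ) * star (U₀ ⟨p.src, p.μ⟩ : Matrix (Fin 2) (Fin 2) ℂ) - 1)
            + (U₀ ⟨p.src, p.μ⟩ : Matrix (Fin 2) (Fin 2) ℂ)
                * ((U ⟨p.src.shift p.μ, p.ν⟩ : Matrix (Fin 2) (Fin 2) ℂ) * star (U₀ ⟨p.src.shift p.μ, p.ν⟩ : Matrix (Fin 2) (Fin 2) ℂ) - 1)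
                * star (U₀ ⟨p.src, p.μ⟩ : Matrix (Fin 2) (Fin 2) ℂ)
            - (U₀ ⟨p.src, p.ν⟩ : Matrix (Fin 2) (Fin 2) ℂ)
                * ((U ⟨p.src.shift p.ν, p.μ⟩ : Matrix (Fin 2) (Fin 2) ℂ) * star (U₀ ⟨p.src.shift p.ν, p.μ⟩ : Matrix (Fin 2) (Fin 2) ℂ) - 1)
                * star (U₀ ⟨p.src, p.ν⟩ : Matrix (Fin 2) (Fin 2) ℂ)
            - ((U ⟨p.src, p.ν⟩ : Matrix (Fin 2) (Fin 2) ℂ) * star (U₀ ⟨p.src, p.ν⟩ : Matrix (Fin 2) (Fin 2) ℂ) - 1)) i₁ i₂‖ ^ 2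
      = ∑ x : Site (F.P K) 0, ∑ μ : Fin (F.P K).d, ∑ ν : Fin (F.P K).d,
          (if μ < ν then ∑ i₁ : Fin 2, ∑ i₂ : Fin 2,
            ‖(B9Eq39Adjoint.curl (torusT (F.P K) 0) (fun κ z => unitsField (toUField U₀) ⟨z, κ⟩) (fun κ z => Y ⟨z, κ⟩) μ ν x) i₁ i₂‖ ^ 2 else 0) := by
    rw [← sum_plaq_eq_sum_ite (fun x μ ν => ∑ i₁ : Fin 2, ∑ i₂ : Fin 2,
      ‖(B9Eq39Adjoint.curl (torusT (F.P K) 0) (fun κ z => unitsField (toUField U₀) ⟨z, κ⟩) (fun κ z => Y ⟨z, κ⟩) μ ν x) i₁ i₂‖ ^ 2)]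
    refine Finset.sum_congr rfl fun p _ => ?_
    rw [curl_bg_eq U₀ Y p]
  have h311 := sum_normSq_le_curl_sq_add_divB_sq_T3 F n K U₀ hε hε1 hU₀ Y havg
  have hdiv0 : ∑ x : Site (F.P K) 0, ∑ j : Fin 2, ∑ k : Fin 2,
      ‖(divB (torusT (F.P K) 0) (fun κ z => unitsField (toUField U₀) ⟨z, κ⟩) (fun κ z => Y ⟨z, κ⟩) x) j k‖ ^ 2 = 0 := by
    refine Finset.sum_eq_zero fun x _ => ?_
    rw [hdiv x]
    simp
  rw [hdiv0, add_zero, ← hcurl] at h311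
  -- (3) the error terms through the bond–plaquette incidence
  have hinc := sum_plaq_bonds_le (P := F.P K) (j := 0) (fun b => ‖Y b‖ ^ 2) (fun b => sq_nonneg _)
  have hd : ((F.P K).d : ℝ) = 3 := by norm_num [T3ContinuumYM3Torus.T3Family.P_d]
  rw [hd] at hinc
  have hc0 : 0 ≤ 2 * a ^ 2 + 128 * δ ^ 2 + 8 * a := by positivity
  have herr := mul_le_mul_of_nonneg_left hinc hc0
  simp only [Finset.sum_add_distrib] at herr
  -- assemble
  simp only [hY] at h311 herr hsum
  rw [← Finset.mul_sum]
  linarith [hsum, h311, herr]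

end Assembly3

end Summit.QuantumFields.YangMills.Theorems.Prop7CovariantCoercivity

end
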